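import Summits.QuantumFields.YangMills.Theorems.UnitScaleTiltProp7SectET3GaugeProjectorT3Rows
import Literature.MathematicalPhysics.QuantumFieldTheory.Balaban1983to89.B9Eq3124GaugeModes
import Summits.QuantumFields.YangMills.Theorems.UnitScaleTiltProp7HfRealityTrace
import HarnessLib

/-!
# Route `UnitScaleTilt`, crux K1 child «MinimiserStabilityRegPr» (stmt-QuantumFields-19200), skeleton v10, stub `stub_existenceMinimalOrbit` (EX),
# route (α) — **THE INFINITESIMAL GAUGE DECOMPOSITION AT THE CHART POINT (Hilbert half of (iii-b) of the `hXtw‴` split): every vector field `δ` is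
# `σ + D_{U₀}λ` with `λ` in the residual gauge algebra `N_S(U₀)` and `σ` in print's restricted Landau slice `R_S(U₀)D*_{U₀}σ = 0`; the averages do not move
# (`Q(U₀)σ = Q(U₀)δ`), so `Qδ = 0 ⟹ σ ∈ ker Q(U₀) ∩ ker R_S(U₀)D*_{U₀}`** — layer-0 brick in ym-inputs-p01∕p05's letters (`QL2`, `DL2`, `DstarL2`, `covLapSite`, `NS`, `RS`)

Cell `ym3-torus`, width seat `ym-ust-20520-w4` (gen 5).  THEOREMS ONLY (0 `def`, 0 `sorry`).  Row (iii-b) «restricted-gauge decomposition» of ★w2-19200 g4's LOCATE «hXtw‴ SPLIT»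
(HOME `ym-ust-19200-w2/g4/LOCATE-HXTW3-SPLIT-w2g4.md`, 19200 evidence #40; ★★OWNER RULING g27-№1 (4) «(iii-b) M in-cell»; ★w2-19200 g4 word 2026-08-28 12:51:46Z «w4: (iii-b) — YES,
the HILBERT HALF as a def-free brick at layer 0, `exists_slice_add_gaugeDir`-shape»).  It is the linearisation of [Balaban1985RegularSpaces] Sect. D's restricted gauge fixing (pp. 89–95; restricted transformations (1.28)–(1.29) p. 81): solvability
of `R_S D*_{U₀}(δ − D_{U₀}λ) = 0` in `λ ∈ N_S(U₀)` is EXACTLY (3.22) «`R f = Δ^η_U λ₀`, `λ₀ ∈ N(Q′)`» (✓`Prop7SectET3GaugeProjector.exists_mem_NS_RS_eq`) together with (3.21) «`R` fixes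
`Δ^η_U N(Q′)`» (✓`RS_apply_covLapSite_of_mem`) and `Δ^η = D*D` (✓`covLapSite`, definitional).  The TRANSPORT of this `U₀`-letter decomposition to `ker QSym(U′)` at the chart point
`U′ = e^{iX}U₀` (the `Dχ(A′₁)` isomorphism + orbit directions) is ★w2-19200 g4's later junction, NOT here.  Nothing here closes the stub; `--supports stmt-QuantumFields-19200 --as helper`,
count-neutral.  YM₃ on T³ is a ladder rung (R3), not the Clay problem; nothing here claims the stub, the crux, d = 4 or the gap.

THE PRINT.  [Balaban1985BackgroundPropagators] (3.20)–(3.23) p. 394 «R = R(U) is an orthogonal projection … onto the subspace ℛ = Δ^η_U N(Q′) … Rf = Δ^η_U λ₀ where λ₀ is a minimum»,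
(3.110) p. 417 ∕ [Balaban1985Variational] (45) p. 285 (the Landau member `RD*A′ = 0` of the slice), (3.115) p. 418 «the averages QA are invariant with respect to gauge transformations
λ ∈ N(Q′)»; [Balaban1985RegularSpaces] (1.28)–(1.29) p. 81 (the restricted gauge transformations), Sect. D pp. 89–95 (the equations for the gauge transformation `u′` whose linearisation this is).

WHAT IS PROVED (member `F`, `h : n ≤ K`, weights `c₀ cB`, background `U₀`; sorry-free, no definition):
* §1 `RS_apply_eq_zero_iff` — the kernel of `R_S(U₀)` is `(Δ^η_{U₀}N_S)^⊥` (lit ✓`B9Eq3124GaugeModes.projR_apply_eq_zero_iff` at the member);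
* §2 ★★`exists_slice_add_gaugeDir_general (δ) : ∃ σ λ, λ ∈ N_S(U₀) ∧ R_S(D*σ) = 0 ∧ Qσ = Qδ ∧ δ = σ + Dλ` (every `δ`; the gauge part is `Q`-invisible),
  ★★★`exists_slice_add_gaugeDir (δ) (hδ : Qδ = 0) : ∃ σ λ, λ ∈ N_S(U₀) ∧ Qσ = 0 ∧ R_S(D*σ) = 0 ∧ δ = σ + Dλ` — ★w2-19200 g4's requested shape VERBATIM;
* §3 ★`exists_slice_add_gaugeDir_pi` — the same READ BACK ON THE ROUTE CARRIERS (`A : PBond (F.P K) 0 → M₂(ℂ)` with `QTwS U₀ A = 0`: `A = S + toL2⁻¹(D_{U₀}(toL2S l))` with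
  `QTwS U₀ S = 0`, `RSPi U₀ (DstarPi U₀ S) = 0`, `toL2S l ∈ N_S(U₀)`), via ✓`QL2_toL2`, ✓`RSPi_apply`, ✓`DstarPi_apply`.
HONEST SCOPE.  Finite-dimensional Hilbert-space bookkeeping over landed letters; no estimate; no uniqueness of `σ` is claimed (none is needed downstream: `ker D_{U₀} ≤ N_S`);
nothing of print asserted beyond the cited definitions.


v1.1 (APPEND-ONLY, same seat; ★★OWNER RULING g27-№4 (3) «(w4-o1′) GO»; consumer: ★w2-19200 g4's ★★`tangentCritical_su2_of_split`, «every `𝔰𝔲(2)`-valued `ξ ∈ ker QSym(U′)` is `τ + G_{U′}(iN)`»):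
§4–§5 THE DECOMPOSITION INSIDE `𝔰𝔲(2)` — for `δ` skew-Hermitian traceless with `Qδ = 0`, BOTH `λ ∈ N_S(U₀)` and `σ` can be taken skew-Hermitian traceless (★★★`exists_slice_add_gaugeDir_skew`
(+ `_at_regPr`, `_pi`)): the complex split's `λ₀` is symmetrised under the conjugation (`½(λ₀ − λ₀ᴴ)`; p03's rows, ✓`RS_comm`∕`QDS_comm`∕`covLapSite_comm`; `δᴴ = −δ`) and under the reflection of
the traceless sector (traceless part; the ✓`Prop7H46RealityTrace` engine; `tr δ = 0`) — both keep `λ ∈ N_S`, `Δ^ηλ = R_S D*δ`.  Also v1.1: docstring LOCATOR ERRATUM per ym3-torus-lit g23 PROGRESS 43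
([Balaban1985RegularSpaces] = CMP 99 (1985) 75–102, (1.28)–(1.29) p. 81, Sect. D pp. 89–95; v1.0 printed CMP 98 ∕ p. 22 ∕ pp. 42–47 in error); no statement or proof of v1.0 changed.

References: T. Bałaban, CMP 99 (1985) 389–434 [Balaban1985BackgroundPropagators] ((3.20)–(3.23) p.394, (3.110) p.417, (3.115) p.418); CMP 102 (1985) 277–309
[Balaban1985Variational] ((45) p.285); CMP 99 (1985) 75–102 [Balaban1985RegularSpaces] ((1.28)–(1.29) p.81, Sect. D pp.89–95).
-/

set_option autoImplicit false

noncomputable section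

open scoped InnerProductSpace ComplexConjugate Matrix.Norms.L2Operator

namespace Summit.QuantumFields.YangMills.Theorems.Prop7GaugeSliceDecomposition

open Literature.MathematicalPhysics.QuantumFieldTheory.Balaban1983to89
open Literature.MathematicalPhysics.QuantumFieldTheory.Balaban1983to89.T3ContinuumYM3Torus
open B9Eq311L2Pairing (WL2)
open B11Eq103H1Complex (SiteL2K BondL2K)
open B9Eq3124GaugeModes (projR_apply_eq_zero_iff)
open Summit.QuantumFields.YangMills.Theorems.Prop7SectET3Transport (periodsT3)
open Summit.QuantumFields.YangMills.Theorems.Prop7SectET3HilbertLetters (W₂ toL2 toL2S toL2B QL2 DL2 DstarL2 covLapSite QL2_toL2)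
open Summit.QuantumFields.YangMills.Theorems.Prop7SymAvgTwSym (QTwS)
open Summit.QuantumFields.YangMills.Theorems.Prop7SectET3GaugeProjector (QDS NS RS RSPi DstarPi mem_NS_iff RS_eq_projR RSPi_apply DstarPi_apply QL2_DL2_eq_zero_of_mem_NS
  exists_mem_NS_RS_eq RS_apply_covLapSite_of_mem)

variable {F : T3Family} {n K : ℕ} {h : n ≤ K} {c₀ cB : ℝ} [Fact (0 < c₀)]

/-! ## §1 The kernel of the gauge projector: `R_S(U₀)f = 0 ↔ f ⊥ Δ^η_{U₀}N_S(U₀)` -/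

/-- **THE KERNEL OF `R_S(U₀)` IS `(Δ^η_{U₀}N_S(U₀))^⊥`**: `R_S f = 0 ↔ ⟪Δ^η_{U₀}λ, f⟫ = 0` for every `λ ∈ N_S(U₀)` (lit ✓`projR_apply_eq_zero_iff` through ✓`RS_eq_projR`) — so the restricted
Landau member `R_S D*_{U₀}σ = 0` says `D*_{U₀}σ ⊥ Δ^η_{U₀}N_S`. [cite: Balaban1985BackgroundPropagators, (3.21)–(3.22) p.394] -/
theorem RS_apply_eq_zero_iff (U₀ : GaugeField (F.P K) 0 (Matrix.specialUnitaryGroup (Fin 2) ℂ)) (f : SiteL2K ℂ 3 (periodsT3 F K) c₀ W₂) :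
    RS F n K h c₀ cB U₀ f = 0 ↔ ∀ l ∈ NS F n K h c₀ cB U₀, ⟪covLapSite F n K c₀ U₀ l, f⟫_ℂ = 0 := by
  rw [RS_eq_projR, projR_apply_eq_zero_iff]
  exact ⟨fun H l hl => H l (LinearMap.mem_ker.1 hl), fun H l hl => H l (LinearMap.mem_ker.2 hl)⟩

/-! ## §2 The decomposition `δ = σ + D_{U₀}λ`, `λ ∈ N_S(U₀)`, `R_S D*_{U₀}σ = 0` -/

/-- ★★ **EVERY VECTOR FIELD SPLITS AS «RESTRICTED-LANDAU SLICE + RESIDUAL GAUGE DIRECTION»**: for every `δ` there are `λ ∈ N_S(U₀)` and `σ` with `R_S(U₀)(D*_{U₀}σ) = 0`,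
`Q(U₀)σ = Q(U₀)δ` (the gauge part is `Q`-invisible, (3.115)) and `δ = σ + D_{U₀}λ`.  Proof: (3.22) `R_S(D*δ) = Δ^η λ` with `λ ∈ N_S` (✓`exists_mem_NS_RS_eq`); `σ := δ − Dλ`; then
`R_S D*σ = R_S D*δ − R_S(Δ^η λ) = Δ^η λ − Δ^η λ = 0` by (3.21) (✓`RS_apply_covLapSite_of_mem`, `Δ^η = D*D`).
[cite: Balaban1985BackgroundPropagators, (3.20)–(3.23) p.394, (3.115) p.418; Balaban1985RegularSpaces, (1.28)–(1.29) p.81] -/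
theorem exists_slice_add_gaugeDir_general (U₀ : GaugeField (F.P K) 0 (Matrix.specialUnitaryGroup (Fin 2) ℂ)) (δ : BondL2K ℂ 3 (periodsT3 F K) c₀ W₂) :
    ∃ (σ : BondL2K ℂ 3 (periodsT3 F K) c₀ W₂) (l : SiteL2K ℂ 3 (periodsT3 F K) c₀ W₂),
      l ∈ NS F n K h c₀ cB U₀ ∧ RS F n K h c₀ cB U₀ (DstarL2 F n K c₀ U₀ σ) = 0 ∧ QL2 F n K h c₀ cB U₀ σ = QL2 F n K h c₀ cB U₀ δ ∧ δ = σ + DL2 F n K c₀ U₀ l := by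
  obtain ⟨l, hl, hR⟩ := exists_mem_NS_RS_eq (h := h) (cB := cB) U₀ (DstarL2 F n K c₀ U₀ δ)
  refine ⟨δ - DL2 F n K c₀ U₀ l, l, hl, ?_, ?_, (sub_add_cancel _ _).symm⟩
  · have hΔ : DstarL2 F n K c₀ U₀ (DL2 F n K c₀ U₀ l) = covLapSite F n K c₀ U₀ l := rfl
    rw [map_sub, map_sub, hR, hΔ, RS_apply_covLapSite_of_mem U₀ hl, sub_self]
  · rw [map_sub, QL2_DL2_eq_zero_of_mem_NS U₀ hl, sub_zero]

/-- ★★★ **THE INFINITESIMAL GAUGE DECOMPOSITION AT THE CHART POINT** (★w2-19200 g4's shape): every `δ` with `Q(U₀)δ = 0` is `δ = σ + D_{U₀}λ` with `λ ∈ N_S(U₀)` and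
`σ ∈ ker Q(U₀) ∩ ker R_S(U₀)D*_{U₀}` — the tangent directions of the constraint surface split into print's linear slice `{QA′ = 0, RD*A′ = 0}` plus residual gauge directions.
[cite: Balaban1985BackgroundPropagators, (3.20)–(3.23) p.394, (3.110) p.417, (3.115) p.418; Balaban1985Variational, (45) p.285; Balaban1985RegularSpaces, Sect. D pp.89–95] -/
theorem exists_slice_add_gaugeDir (U₀ : GaugeField (F.P K) 0 (Matrix.specialUnitaryGroup (Fin 2) ℂ)) (δ : BondL2K ℂ 3 (periodsT3 F K) c₀ W₂)
    (hδ : QL2 F n K h c₀ cB U₀ δ = 0) :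
    ∃ (σ : BondL2K ℂ 3 (periodsT3 F K) c₀ W₂) (l : SiteL2K ℂ 3 (periodsT3 F K) c₀ W₂),
      l ∈ NS F n K h c₀ cB U₀ ∧ QL2 F n K h c₀ cB U₀ σ = 0 ∧ RS F n K h c₀ cB U₀ (DstarL2 F n K c₀ U₀ σ) = 0 ∧ δ = σ + DL2 F n K c₀ U₀ l := by
  obtain ⟨σ, l, hl, hR, hQ, hδ'⟩ := exists_slice_add_gaugeDir_general (h := h) (cB := cB) U₀ δ
  exact ⟨σ, l, hl, by rw [hQ, hδ], hR, hδ'⟩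

/-- **THE GAUGE PART IS `Q`-INVISIBLE AND THE SLICE PART IS UNIQUE UP TO `D_{U₀}(N_S)`-TRANSLATES WITH `R_S D* = 0`** — the elementary bookkeeping consumers use: if `δ = σ + Dλ` with
`λ ∈ N_S(U₀)` then `Qδ = Qσ`. [cite: Balaban1985BackgroundPropagators, (3.115) p.418] -/
theorem QL2_eq_of_slice_add_gaugeDir (U₀ : GaugeField (F.P K) 0 (Matrix.specialUnitaryGroup (Fin 2) ℂ)) {δ σ : BondL2K ℂ 3 (periodsT3 F K) c₀ W₂}
    {l : SiteL2K ℂ 3 (periodsT3 F K) c₀ W₂} (hl : l ∈ NS F n K h c₀ cB U₀) (hδ : δ = σ + DL2 F n K c₀ U₀ l) :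
    QL2 F n K h c₀ cB U₀ δ = QL2 F n K h c₀ cB U₀ σ := by
  rw [hδ, map_add, QL2_DL2_eq_zero_of_mem_NS U₀ hl, add_zero]

/-! ## §3 Read back on the route carriers -/

/-- ★ **THE DECOMPOSITION ON THE ROUTE'S FUNCTIONS**: a fine vector field `A : PBond (F.P K) 0 → M₂(ℂ)` with `QTwS U₀ A = 0` is `A = S + toL2⁻¹(D_{U₀}(toL2S l))` with
`QTwS U₀ S = 0`, the restricted Landau member `RSPi U₀ (DstarPi U₀ S) = 0` (✓`RSPi_apply`∕✓`DstarPi_apply`) and `toL2S l ∈ N_S(U₀)` (the stencil of `toL2⁻¹ ∘ D_{U₀} ∘ toL2S` is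
✓`DL2_apply`: `η⁻¹(U₀(b)·l(b₊)·U₀(b)⁻¹ − l(b₋))`). [cite: Balaban1985BackgroundPropagators, (3.3) p.391, (3.21) p.394, (3.110) p.417; Balaban1985Variational, (45) p.285] -/
theorem exists_slice_add_gaugeDir_pi [Fact (0 < cB)] (U₀ : GaugeField (F.P K) 0 (Matrix.specialUnitaryGroup (Fin 2) ℂ)) (A : PBond (F.P K) 0 → Matrix (Fin 2) (Fin 2) ℂ)
    (hA : QTwS F n K h U₀ A = 0) :
    ∃ (S : PBond (F.P K) 0 → Matrix (Fin 2) (Fin 2) ℂ) (l : Site (F.P K) 0 → Matrix (Fin 2) (Fin 2) ℂ),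
      toL2S F K c₀ l ∈ NS F n K h c₀ cB U₀ ∧ QTwS F n K h U₀ S = 0 ∧ RSPi F n K h c₀ cB U₀ (DstarPi F n K c₀ U₀ S) = 0 ∧
        A = S + (toL2 F K c₀).symm (DL2 F n K c₀ U₀ (toL2S F K c₀ l)) := by
  have hδ : QL2 F n K h c₀ cB U₀ (toL2 F K c₀ A) = 0 := by rw [QL2_toL2, hA, map_zero]
  obtain ⟨σ, l', hl', hQ, hR, hdec⟩ := exists_slice_add_gaugeDir (h := h) (cB := cB) U₀ (toL2 F K c₀ A) hδ
  refine ⟨(toL2 F K c₀).symm σ, (toL2S F K c₀).symm l', by rwa [LinearEquiv.apply_symm_apply], ?_, ?_, ?_⟩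
  · have hQ' := hQ
    rw [← (toL2 F K c₀).apply_symm_apply σ, QL2_toL2] at hQ'
    exact (toL2B F n cB).injective (by rw [hQ', map_zero])
  · rw [RSPi_apply, DstarPi_apply, LinearEquiv.apply_symm_apply, LinearEquiv.apply_symm_apply, hR, map_zero]
  · apply (toL2 F K c₀).injective
    rw [map_add, LinearEquiv.apply_symm_apply, LinearEquiv.apply_symm_apply, LinearEquiv.apply_symm_apply]
    exact hdec

/-! # v1.1 APPEND — the `𝔰𝔲(2)` refinement -/

section SU2

open T3PrintedRegularMinimiser (RegPr)
open B11Eq103H1ComplexReality (starProjection_map_comm_of_anti)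
open Summit.QuantumFields.YangMills.Theorems.Prop7SectET3HilbertLetters (inner_toL2 inner_toL2B adjoint_DL2)
open Summit.QuantumFields.YangMills.Theorems.Prop7SymAvgTwSym (QTwS_star_comm_of_regPr QTwS_scalar_of_regPr QTwS_traceless_of_regPr)
open Summit.QuantumFields.YangMills.Theorems.Prop7SectET3PropagatorsReality (map_zero_of_map_add map_sub_of_map_add DstarL2_comm' QDS_comm RS_comm covLapSite_comm)
open Summit.QuantumFields.YangMills.Theorems.Prop7SectET3HilbertLettersReality (toL2_star_star toL2_star_add toL2_star_smul_real inner_toL2_star toL2S_star_star toL2S_star_add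
  toL2S_star_smul_real inner_toL2S_star toL2B_star_star toL2B_star_add toL2B_star_smul_real inner_toL2B_star DL2_star_comm QL2_star_comm_of DstarL2_star_comm covLapSite_star_comm
  trace_DL2_apply_eq_zero)
open Summit.QuantumFields.YangMills.Theorems.Prop7H46RealityTrace (reflection_comm_of_mapsTo mapsTo_orthogonal_of_adjoint exists_smul_one_of_trace_orthogonal trace_conjTranspose_mul_smul_one
  trace_DstarL2_apply_eq_zero)

/-! ## §4 (v1.1) The conjugation preserves the traceless sector of the gauge parameters -/

omit [Fact (0 < c₀)] in
/-- **THE CONJUGATION `g ↦ toL2S (toL2S⁻¹ g)ᴴ` MAPS THE TRACELESS SECTOR OF THE GAUGE PARAMETERS INTO ITSELF** (`tr(Xᴴ) = conj (tr X)`). [cite: Balaban1985BackgroundPropagators, p.393] -/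
theorem conj_mem_of_traceless {g : SiteL2K ℂ 3 (periodsT3 F K) c₀ W₂} (hg : ∀ x, ((toL2S F K c₀).symm g x).trace = 0) (x : Site (F.P K) 0) :
    ((toL2S F K c₀).symm (toL2S F K c₀ (star ((toL2S F K c₀).symm g))) x).trace = 0 := by
  rw [LinearEquiv.symm_apply_apply, Pi.star_apply, Matrix.star_eq_conjTranspose, Matrix.trace_conjTranspose, hg x, star_zero]

/-! ## §5 (v1.1) The decomposition inside `𝔰𝔲(2)` -/

/-- ★★★ **THE INFINITESIMAL GAUGE DECOMPOSITION INSIDE `𝔰𝔲(2)`**: at any background `U₀` whose averaging `QTwS U₀` is real (`hQ`) and respects the traceless ∕ scalar sectors (`hQtr`∕`hQsc`),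
every skew-Hermitian traceless `δ` with `Q(U₀)δ = 0` is `δ = σ + D_{U₀}λ` with `λ ∈ N_S(U₀)` skew-Hermitian traceless and `σ` skew-Hermitian traceless in the restricted Landau slice
(`Qσ = 0`, `R_S(U₀)(D*_{U₀}σ) = 0`).  Proof: symmetrise the complex split's `λ₀` under the conjugation ((R): `½(λ₀ − λ₀ᴴ)`) and under the traceless reflection ((T): traceless part), both of which
commute with `D`, `Q′`, `Δ^η`, `R_S` and fix `R_S D*δ`. [cite: Balaban1985BackgroundPropagators, (3.20)–(3.23) p.394, p.393, (3.110) p.417; Balaban1985Variational, (51) p.286, (82)–(83) p.290] -/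
theorem exists_slice_add_gaugeDir_skew [Fact (0 < cB)] (U₀ : GaugeField (F.P K) 0 (Matrix.specialUnitaryGroup (Fin 2) ℂ))
    (hQ : ∀ A : PBond (F.P K) 0 → Matrix (Fin 2) (Fin 2) ℂ, QTwS F n K h U₀ (star A) = star (QTwS F n K h U₀ A))
    (hQtr : ∀ A : PBond (F.P K) 0 → Matrix (Fin 2) (Fin 2) ℂ, (∀ b, (A b).trace = 0) → ∀ c, (QTwS F n K h U₀ A c).trace = 0)
    (hQsc : ∀ c : PBond (F.P K) 0 → ℂ, ∃ d : PBond (F.P n) 0 → ℂ, QTwS F n K h U₀ (fun b => c b • (1 : Matrix (Fin 2) (Fin 2) ℂ)) = fun c' => d c' • 1)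
    (δ : BondL2K ℂ 3 (periodsT3 F K) c₀ W₂) (hδQ : QL2 F n K h c₀ cB U₀ δ = 0)
    (hδ : ∀ b, star ((toL2 F K c₀).symm δ b) = -(toL2 F K c₀).symm δ b ∧ ((toL2 F K c₀).symm δ b).trace = 0) :
    ∃ (σ : BondL2K ℂ 3 (periodsT3 F K) c₀ W₂) (l : SiteL2K ℂ 3 (periodsT3 F K) c₀ W₂),
      l ∈ NS F n K h c₀ cB U₀ ∧ (∀ x, star ((toL2S F K c₀).symm l x) = -(toL2S F K c₀).symm l x ∧ ((toL2S F K c₀).symm l x).trace = 0) ∧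
      (∀ b, star ((toL2 F K c₀).symm σ b) = -(toL2 F K c₀).symm σ b ∧ ((toL2 F K c₀).symm σ b).trace = 0) ∧
      QL2 F n K h c₀ cB U₀ σ = 0 ∧ RS F n K h c₀ cB U₀ (DstarL2 F n K c₀ U₀ σ) = 0 ∧ δ = σ + DL2 F n K c₀ U₀ l := by
  -- (3.22): the complex split's gauge parameter
  obtain ⟨l₀, hl₀, hR⟩ := exists_mem_NS_RS_eq (h := h) (cB := cB) U₀ (DstarL2 F n K c₀ U₀ δ)
  ------------------------------------------------------------------
  -- (R) the conjugation triple: `cE`, `cS`, `cF`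
  ------------------------------------------------------------------
  set cE : BondL2K ℂ 3 (periodsT3 F K) c₀ W₂ → BondL2K ℂ 3 (periodsT3 F K) c₀ W₂ := fun f => toL2 F K c₀ (star ((toL2 F K c₀).symm f)) with hcE
  set cS : SiteL2K ℂ 3 (periodsT3 F K) c₀ W₂ → SiteL2K ℂ 3 (periodsT3 F K) c₀ W₂ := fun g => toL2S F K c₀ (star ((toL2S F K c₀).symm g)) with hcS
  set cF : WL2 ℂ (fun _ : PBond (F.P n) 0 => cB) W₂ → WL2 ℂ (fun _ : PBond (F.P n) 0 => cB) W₂ := fun y => toL2B F n cB (star ((toL2B F n cB).symm y)) with hcF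
  have hkindc : ((∀ x y : BondL2K ℂ 3 (periodsT3 F K) c₀ W₂, ⟪cE x, cE y⟫_ℂ = ⟪y, x⟫_ℂ) ∧ (∀ x y : SiteL2K ℂ 3 (periodsT3 F K) c₀ W₂, ⟪cS x, cS y⟫_ℂ = ⟪y, x⟫_ℂ) ∧
      (∀ x y : WL2 ℂ (fun _ : PBond (F.P n) 0 => cB) W₂, ⟪cF x, cF y⟫_ℂ = ⟪y, x⟫_ℂ)) ∨
    ((∀ x y : BondL2K ℂ 3 (periodsT3 F K) c₀ W₂, ⟪cE x, cE y⟫_ℂ = ⟪x, y⟫_ℂ) ∧ (∀ x y : SiteL2K ℂ 3 (periodsT3 F K) c₀ W₂, ⟪cS x, cS y⟫_ℂ = ⟪x, y⟫_ℂ) ∧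
      (∀ x y : WL2 ℂ (fun _ : PBond (F.P n) 0 => cB) W₂, ⟪cF x, cF y⟫_ℂ = ⟪x, y⟫_ℂ)) := Or.inl ⟨inner_toL2_star, inner_toL2S_star, inner_toL2B_star⟩
  have hcEadd : ∀ f g, cE (f + g) = cE f + cE g := toL2_star_add
  have hcSadd : ∀ f g, cS (f + g) = cS f + cS g := toL2S_star_add
  have hcS2 : ∀ g, cS (cS g) = g := toL2S_star_star
  have hcSsmul : ∀ (r : ℝ) (g : SiteL2K ℂ 3 (periodsT3 F K) c₀ W₂), cS (((r : ℝ) : ℂ) • g) = ((r : ℝ) : ℂ) • cS g := toL2S_star_smul_real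
  have hDc : ∀ g, DL2 F n K c₀ U₀ (cS g) = cE (DL2 F n K c₀ U₀ g) := DL2_star_comm U₀
  have hQc : ∀ f, QL2 F n K h c₀ cB U₀ (cE f) = cF (QL2 F n K h c₀ cB U₀ f) := QL2_star_comm_of U₀ hQ
  have hDsc : ∀ f, DstarL2 F n K c₀ U₀ (cE f) = cS (DstarL2 F n K c₀ U₀ f) := DstarL2_star_comm (n := n) U₀
  have hΔc : ∀ g, covLapSite F n K c₀ U₀ (cS g) = cS (covLapSite F n K c₀ U₀ g) := covLapSite_star_comm (n := n) U₀
  have hRSc : ∀ g, RS F n K h c₀ cB U₀ (cS g) = cS (RS F n K h c₀ cB U₀ g) :=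
    RS_comm F n K h c₀ cB U₀ cE cS cF hkindc toL2S_star_add toL2B_star_add toL2_star_star toL2S_star_star hDc hQc
  have hQDSc : ∀ s, QDS F n K h c₀ cB U₀ (cS s) = cF (QDS F n K h c₀ cB U₀ s) := QDS_comm F n K h c₀ cB U₀ cE cS cF hDc hQc
  have hcF0 : cF 0 = 0 := map_zero_of_map_add cF toL2B_star_add
  -- `N_S` is conjugation-stable
  have hNSc : ∀ s ∈ NS F n K h c₀ cB U₀, cS s ∈ NS F n K h c₀ cB U₀ := fun s hs => by
    have hs' : QDS F n K h c₀ cB U₀ s = 0 := LinearMap.mem_ker.1 hs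
    exact LinearMap.mem_ker.2 (by rw [hQDSc, hs', hcF0])
  -- `δ` is anti-fixed by the conjugation
  have hδc : cE δ = -δ := by
    have hfun : star ((toL2 F K c₀).symm δ) = -(toL2 F K c₀).symm δ := funext fun b => by rw [Pi.star_apply, Pi.neg_apply, (hδ b).1]
    show toL2 F K c₀ (star ((toL2 F K c₀).symm δ)) = -δ
    rw [hfun, map_neg, LinearEquiv.apply_symm_apply]
  -- (R): `λ₁ := ½(λ₀ − λ₀ᴴ)`
  set l₁ : SiteL2K ℂ 3 (periodsT3 F K) c₀ W₂ := ((1 / 2 : ℝ) : ℂ) • (l₀ - cS l₀) with hl₁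
  have hl₁N : l₁ ∈ NS F n K h c₀ cB U₀ := Submodule.smul_mem _ _ (Submodule.sub_mem _ hl₀ (hNSc l₀ hl₀))
  have hRδc : cS (RS F n K h c₀ cB U₀ (DstarL2 F n K c₀ U₀ δ)) = -RS F n K h c₀ cB U₀ (DstarL2 F n K c₀ U₀ δ) := by
    rw [← hRSc, ← hDsc, hδc, map_neg, map_neg]
  have hΔl₁ : covLapSite F n K c₀ U₀ l₁ = covLapSite F n K c₀ U₀ l₀ := by
    rw [hl₁, map_smul, map_sub, hΔc, ← hR, hRδc, sub_neg_eq_add, ← two_smul ℂ, smul_smul]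
    norm_num
  have hl₁c : cS l₁ = -l₁ := by
    rw [hl₁, hcSsmul, map_sub_of_map_add cS hcSadd, hcS2, ← smul_neg, neg_sub]
  ------------------------------------------------------------------
  -- (T) the reflection triple of the traceless sectors
  ------------------------------------------------------------------
  let VE : Submodule ℂ (BondL2K ℂ 3 (periodsT3 F K) c₀ W₂) :=
    { carrier := {f | ∀ b, ((toL2 F K c₀).symm f b).trace = 0}
      add_mem' := fun {f g} hf hg b => by rw [map_add, Pi.add_apply, Matrix.trace_add, hf b, hg b, add_zero]
      zero_mem' := fun b => by rw [map_zero, Pi.zero_apply, Matrix.trace_zero]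
      smul_mem' := fun r f hf b => by rw [map_smul, Pi.smul_apply, Matrix.trace_smul, hf b, smul_zero] }
  let VS : Submodule ℂ (SiteL2K ℂ 3 (periodsT3 F K) c₀ W₂) :=
    { carrier := {g | ∀ x, ((toL2S F K c₀).symm g x).trace = 0}
      add_mem' := fun {f g} hf hg x => by rw [map_add, Pi.add_apply, Matrix.trace_add, hf x, hg x, add_zero]
      zero_mem' := fun x => by rw [map_zero, Pi.zero_apply, Matrix.trace_zero]
      smul_mem' := fun r f hf x => by rw [map_smul, Pi.smul_apply, Matrix.trace_smul, hf x, smul_zero] }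
  let VF : Submodule ℂ (WL2 ℂ (fun _ : PBond (F.P n) 0 => cB) W₂) :=
    { carrier := {y | ∀ c, ((toL2B F n cB).symm y c).trace = 0}
      add_mem' := fun {f g} hf hg c => by rw [map_add, Pi.add_apply, Matrix.trace_add, hf c, hg c, add_zero]
      zero_mem' := fun c => by rw [map_zero, Pi.zero_apply, Matrix.trace_zero]
      smul_mem' := fun r f hf c => by rw [map_smul, Pi.smul_apply, Matrix.trace_smul, hf c, smul_zero] }
  haveI : CompleteSpace VE := FiniteDimensional.complete ℂ VE
  haveI : CompleteSpace VS := FiniteDimensional.complete ℂ VS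
  haveI : CompleteSpace VF := FiniteDimensional.complete ℂ VF
  have memVE : ∀ A : PBond (F.P K) 0 → Matrix (Fin 2) (Fin 2) ℂ, toL2 F K c₀ A ∈ VE ↔ ∀ b, (A b).trace = 0 := fun A => by
    change (∀ b, ((toL2 F K c₀).symm (toL2 F K c₀ A) b).trace = 0) ↔ _
    rw [LinearEquiv.symm_apply_apply]
  have memVF : ∀ B : PBond (F.P n) 0 → Matrix (Fin 2) (Fin 2) ℂ, toL2B F n cB B ∈ VF ↔ ∀ c, (B c).trace = 0 := fun B => by
    change (∀ c, ((toL2B F n cB).symm (toL2B F n cB B) c).trace = 0) ↔ _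
    rw [LinearEquiv.symm_apply_apply]
  have scalar_mem_VFc : ∀ d : PBond (F.P n) 0 → ℂ, toL2B F n cB (fun c => d c • (1 : Matrix (Fin 2) (Fin 2) ℂ)) ∈ VFᗮ := by
    intro d
    rw [Submodule.mem_orthogonal]
    intro v hv
    obtain ⟨B, rfl⟩ : ∃ B, v = toL2B F n cB B := ⟨(toL2B F n cB).symm v, ((toL2B F n cB).apply_symm_apply v).symm⟩
    rw [inner_toL2B]
    refine mul_eq_zero_of_right _ (Finset.sum_eq_zero fun c _ => trace_conjTranspose_mul_smul_one ((memVF B).1 hv c) (d c))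
  have exists_scalar_of_mem_VEc : ∀ u ∈ VEᗮ, ∃ c : PBond (F.P K) 0 → ℂ, u = toL2 F K c₀ (fun b => c b • (1 : Matrix (Fin 2) (Fin 2) ℂ)) := by
    intro u hu
    obtain ⟨A, rfl⟩ : ∃ A, u = toL2 F K c₀ A := ⟨(toL2 F K c₀).symm u, ((toL2 F K c₀).apply_symm_apply u).symm⟩
    have hpt : ∀ b, ∃ c : ℂ, A b = c • (1 : Matrix (Fin 2) (Fin 2) ℂ) := by
      intro b
      refine exists_smul_one_of_trace_orthogonal (A b) fun X hX => ?_
      have hmem : toL2 F K c₀ (Pi.single b X) ∈ VE := (memVE _).2 fun b' => by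
        by_cases hb : b' = b
        · subst hb; rw [Pi.single_eq_same]; exact hX
        · rw [Pi.single_eq_of_ne hb, Matrix.trace_zero]
      have h0 := (Submodule.mem_orthogonal _ _).1 hu _ hmem
      rw [inner_toL2, Finset.sum_eq_single b (fun b' _ hb' => by rw [Pi.single_eq_of_ne hb', Matrix.conjTranspose_zero, Matrix.zero_mul, Matrix.trace_zero])
        (fun hb => (hb (Finset.mem_univ b)).elim), Pi.single_eq_same] at h0
      have hc₀ : ((c₀ : ℝ) : ℂ) ≠ 0 := Complex.ofReal_ne_zero.2 (ne_of_gt (Fact.out : 0 < c₀))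
      exact (mul_eq_zero.1 h0).resolve_left hc₀
    choose c hc using hpt
    exact ⟨c, congrArg _ (funext hc)⟩
  have hD_V : ∀ g ∈ VS, DL2 F n K c₀ U₀ g ∈ VE := by
    intro g hg
    obtain ⟨l, rfl⟩ : ∃ l, g = toL2S F K c₀ l := ⟨(toL2S F K c₀).symm g, ((toL2S F K c₀).apply_symm_apply g).symm⟩
    have hl : ∀ x, (l x).trace = 0 := fun x => by have := hg x; rwa [LinearEquiv.symm_apply_apply] at this
    exact fun b' => trace_DL2_apply_eq_zero U₀ l hl b'
  have hDstar_V : ∀ f ∈ VE, LinearMap.adjoint (DL2 F n K c₀ U₀) f ∈ VS := by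
    intro f hf
    obtain ⟨A, rfl⟩ : ∃ A, f = toL2 F K c₀ A := ⟨(toL2 F K c₀).symm f, ((toL2 F K c₀).apply_symm_apply f).symm⟩
    rw [adjoint_DL2]
    exact fun x => trace_DstarL2_apply_eq_zero F n K c₀ U₀ A ((memVE A).1 hf) x
  have hD_Vc : ∀ u ∈ VSᗮ, DL2 F n K c₀ U₀ u ∈ VEᗮ := fun u hu => mapsTo_orthogonal_of_adjoint _ VS VE hDstar_V hu
  have hQ_V : ∀ f ∈ VE, QL2 F n K h c₀ cB U₀ f ∈ VF := by
    intro f hf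
    obtain ⟨A, rfl⟩ : ∃ A, f = toL2 F K c₀ A := ⟨(toL2 F K c₀).symm f, ((toL2 F K c₀).apply_symm_apply f).symm⟩
    rw [QL2_toL2]
    exact (memVF _).2 (hQtr A ((memVE A).1 hf))
  have hQ_Vc : ∀ u ∈ VEᗮ, QL2 F n K h c₀ cB U₀ u ∈ VFᗮ := by
    intro u hu
    obtain ⟨c, rfl⟩ := exists_scalar_of_mem_VEc u hu
    obtain ⟨d, hd⟩ := hQsc c
    rw [QL2_toL2, hd]
    exact scalar_mem_VFc d
  -- the reflections intertwined by the data
  have hDρ : ∀ s, DL2 F n K c₀ U₀ (VS.reflection s) = VE.reflection (DL2 F n K c₀ U₀ s) := reflection_comm_of_mapsTo VS VE _ hD_V hD_Vc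
  have hQρ : ∀ x, QL2 F n K h c₀ cB U₀ (VE.reflection x) = VF.reflection (QL2 F n K h c₀ cB U₀ x) := reflection_comm_of_mapsTo VE VF _ hQ_V hQ_Vc
  have hkindρ : ((∀ x y : BondL2K ℂ 3 (periodsT3 F K) c₀ W₂, ⟪VE.reflection x, VE.reflection y⟫_ℂ = ⟪y, x⟫_ℂ) ∧
      (∀ x y : SiteL2K ℂ 3 (periodsT3 F K) c₀ W₂, ⟪VS.reflection x, VS.reflection y⟫_ℂ = ⟪y, x⟫_ℂ) ∧
      (∀ x y : WL2 ℂ (fun _ : PBond (F.P n) 0 => cB) W₂, ⟪VF.reflection x, VF.reflection y⟫_ℂ = ⟪y, x⟫_ℂ)) ∨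
    ((∀ x y : BondL2K ℂ 3 (periodsT3 F K) c₀ W₂, ⟪VE.reflection x, VE.reflection y⟫_ℂ = ⟪x, y⟫_ℂ) ∧
      (∀ x y : SiteL2K ℂ 3 (periodsT3 F K) c₀ W₂, ⟪VS.reflection x, VS.reflection y⟫_ℂ = ⟪x, y⟫_ℂ) ∧
      (∀ x y : WL2 ℂ (fun _ : PBond (F.P n) 0 => cB) W₂, ⟪VF.reflection x, VF.reflection y⟫_ℂ = ⟪x, y⟫_ℂ)) :=
    Or.inr ⟨fun x y => VE.reflection.inner_map_map x y, fun x y => VS.reflection.inner_map_map x y, fun x y => VF.reflection.inner_map_map x y⟩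
  have hDsρ : ∀ x, DstarL2 F n K c₀ U₀ (VE.reflection x) = VS.reflection (DstarL2 F n K c₀ U₀ x) :=
    DstarL2_comm' F n K c₀ cB U₀ (fun x => VE.reflection x) (fun s => VS.reflection s) (fun y => VF.reflection y) hkindρ
      (fun x => VE.reflection_reflection x) (fun s => VS.reflection_reflection s) hDρ
  have hΔρ : ∀ s, covLapSite F n K c₀ U₀ (VS.reflection s) = VS.reflection (covLapSite F n K c₀ U₀ s) :=
    covLapSite_comm F n K c₀ U₀ (fun x => VE.reflection x) (fun s => VS.reflection s) hDρ hDsρ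
  have hRSρ : ∀ s, RS F n K h c₀ cB U₀ (VS.reflection s) = VS.reflection (RS F n K h c₀ cB U₀ s) :=
    RS_comm F n K h c₀ cB U₀ (fun x => VE.reflection x) (fun s => VS.reflection s) (fun y => VF.reflection y) hkindρ
      (fun x y => map_add _ x y) (fun x y => map_add _ x y) (fun x => VE.reflection_reflection x) (fun s => VS.reflection_reflection s) hDρ hQρ
  have hQDSρ : ∀ s, QDS F n K h c₀ cB U₀ (VS.reflection s) = VF.reflection (QDS F n K h c₀ cB U₀ s) :=
    QDS_comm F n K h c₀ cB U₀ (fun x => VE.reflection x) (fun s => VS.reflection s) (fun y => VF.reflection y) hDρ hQρ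
  -- `N_S` is reflection-stable
  have hNSρ : ∀ s ∈ NS F n K h c₀ cB U₀, VS.reflection s ∈ NS F n K h c₀ cB U₀ := fun s hs => by
    have hs' : QDS F n K h c₀ cB U₀ s = 0 := LinearMap.mem_ker.1 hs
    exact LinearMap.mem_ker.2 (by rw [hQDSρ, hs', map_zero])
  -- `R_S D*δ` is traceless (fixed by the reflection): `D*δ ∈ V_S`, and `R_S` commutes with `ρ`
  have hδV : δ ∈ VE := fun b => (hδ b).2
  have hDsδV : DstarL2 F n K c₀ U₀ δ ∈ VS := by rw [← adjoint_DL2]; exact hDstar_V δ hδV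
  have hRfix : VS.reflection (RS F n K h c₀ cB U₀ (DstarL2 F n K c₀ U₀ δ)) = RS F n K h c₀ cB U₀ (DstarL2 F n K c₀ U₀ δ) := by
    rw [← hRSρ, Submodule.reflection_mem_subspace_eq_self hDsδV]
  -- the conjugation commutes with the reflection on the gauge parameters
  have hcρ : ∀ g, cS (VS.reflection g) = VS.reflection (cS g) := fun g => by
    have hP : ∀ x, VS.starProjection (cS x) = cS (VS.starProjection x) :=
      starProjection_map_comm_of_anti VS cS toL2S_star_add inner_toL2S_star toL2S_star_star (fun k hk x => conj_mem_of_traceless hk x)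
    rw [Submodule.reflection_apply, Submodule.reflection_apply, map_sub_of_map_add cS hcSadd, two_smul, two_smul, hcSadd, hP]
  -- (T): `λ₂ := ½(λ₁ + ρλ₁)` = the traceless part
  set l₂ : SiteL2K ℂ 3 (periodsT3 F K) c₀ W₂ := ((1 / 2 : ℝ) : ℂ) • (l₁ + VS.reflection l₁) with hl₂
  have hl₂N : l₂ ∈ NS F n K h c₀ cB U₀ := Submodule.smul_mem _ _ (Submodule.add_mem _ hl₁N (hNSρ l₁ hl₁N))
  have hΔl₂ : covLapSite F n K c₀ U₀ l₂ = covLapSite F n K c₀ U₀ l₀ := by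
    rw [hl₂, map_smul, map_add, hΔρ, hΔl₁, ← hR, hRfix, ← two_smul ℂ, smul_smul]
    norm_num
  have hl₂ρ : VS.reflection l₂ = l₂ := by
    rw [hl₂, map_smul, map_add, Submodule.reflection_reflection, add_comm]
  have hl₂V : l₂ ∈ VS := (Submodule.reflection_eq_self_iff _).1 hl₂ρ
  have hl₂c : cS l₂ = -l₂ := by
    rw [hl₂, hcSsmul, hcSadd, hcρ, hl₁c, map_neg, ← neg_add, smul_neg]
  ------------------------------------------------------------------
  -- the slice part `σ := δ − Dλ₂`
  ------------------------------------------------------------------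
  refine ⟨δ - DL2 F n K c₀ U₀ l₂, l₂, hl₂N, fun x => ⟨?_, hl₂V x⟩, fun b => ⟨?_, ?_⟩, ?_, ?_, (sub_add_cancel _ _).symm⟩
  · -- `λ₂` skew-Hermitian, read pointwise
    have hfun := congrArg (toL2S F K c₀).symm hl₂c
    rw [LinearEquiv.symm_apply_apply, map_neg] at hfun
    have hx := congrFun hfun x
    rw [Pi.star_apply, Pi.neg_apply] at hx
    exact hx
  · -- `σ` skew-Hermitian: `cE σ = −σ`
    have hσc : cE (δ - DL2 F n K c₀ U₀ l₂) = -(δ - DL2 F n K c₀ U₀ l₂) := by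
      rw [map_sub_of_map_add cE hcEadd, hδc, ← hDc, hl₂c, map_neg, sub_neg_eq_add, neg_add_eq_sub, neg_sub]
    have hfun := congrArg (toL2 F K c₀).symm hσc
    rw [LinearEquiv.symm_apply_apply, map_neg] at hfun
    have hb := congrFun hfun b
    rw [Pi.star_apply, Pi.neg_apply] at hb
    exact hb
  · -- `σ` traceless
    have hDl₂ : DL2 F n K c₀ U₀ l₂ ∈ VE := hD_V l₂ hl₂V
    rw [map_sub, Pi.sub_apply, Matrix.trace_sub, (hδ b).2, hDl₂ b, sub_zero]
  · -- `Qσ = 0`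
    rw [map_sub, hδQ, QL2_DL2_eq_zero_of_mem_NS U₀ hl₂N, sub_zero]
  · -- `R_S D*σ = 0`
    have hΔ : DstarL2 F n K c₀ U₀ (DL2 F n K c₀ U₀ l₂) = covLapSite F n K c₀ U₀ l₂ := rfl
    rw [map_sub, map_sub, hΔ, RS_apply_covLapSite_of_mem U₀ hl₂N, hΔl₂, hR, sub_self]

/-! ### (v1.1) At `U₀ ∈ 𝔘_k(ε₀)`; route-carrier reading -/

/-- ★★★ **THE `𝔰𝔲(2)` DECOMPOSITION AT `U₀ ∈ 𝔘_k(ε₀)` IN THE WINDOWS `10⁹L²e ≤ 1`, `10¹²L³ε₀ ≤ 1`** — the `QTwS` rows BY NAME (★w5 ✓`QTwS_star_comm_of_regPr`∕`QTwS_traceless_of_regPr`∕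
`QTwS_scalar_of_regPr`): no displayed row. [cite: Balaban1985BackgroundPropagators, (3.20)–(3.23) p.394, p.393; Balaban1985Variational, (51) p.286, (82)–(83) p.290] -/
theorem exists_slice_add_gaugeDir_skew_at_regPr [Fact (0 < cB)] [Fact (0 < (F.L : ℝ))] [Fact (0 < ((F.L : ℝ)⁻¹) ^ (K - n))]
    {ε₀ e : ℝ} (hε₀ : 0 < ε₀) (he : 0 < e) (hWe : 10 ^ 9 * (F.L : ℝ) ^ 2 * e ≤ 1) (hWε : 10 ^ 12 * (F.L : ℝ) ^ 3 * ε₀ ≤ 1)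
    (U₀ : GaugeField (F.P K) 0 (Matrix.specialUnitaryGroup (Fin 2) ℂ)) (hreg : RegPr F n K ε₀ U₀)
    (δ : BondL2K ℂ 3 (periodsT3 F K) c₀ W₂) (hδQ : QL2 F n K h c₀ cB U₀ δ = 0)
    (hδ : ∀ b, star ((toL2 F K c₀).symm δ b) = -(toL2 F K c₀).symm δ b ∧ ((toL2 F K c₀).symm δ b).trace = 0) :
    ∃ (σ : BondL2K ℂ 3 (periodsT3 F K) c₀ W₂) (l : SiteL2K ℂ 3 (periodsT3 F K) c₀ W₂),
      l ∈ NS F n K h c₀ cB U₀ ∧ (∀ x, star ((toL2S F K c₀).symm l x) = -(toL2S F K c₀).symm l x ∧ ((toL2S F K c₀).symm l x).trace = 0) ∧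
      (∀ b, star ((toL2 F K c₀).symm σ b) = -(toL2 F K c₀).symm σ b ∧ ((toL2 F K c₀).symm σ b).trace = 0) ∧
      QL2 F n K h c₀ cB U₀ σ = 0 ∧ RS F n K h c₀ cB U₀ (DstarL2 F n K c₀ U₀ σ) = 0 ∧ δ = σ + DL2 F n K c₀ U₀ l :=
  exists_slice_add_gaugeDir_skew U₀ (QTwS_star_comm_of_regPr F h hε₀ he hWe hWε U₀ hreg) (QTwS_traceless_of_regPr F h hε₀ he hWe hWε U₀ hreg)
    (QTwS_scalar_of_regPr F h hε₀ hWε U₀ hreg) δ hδQ hδ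

/-- ★ **THE `𝔰𝔲(2)` DECOMPOSITION ON THE ROUTE'S FUNCTIONS**: an `𝔰𝔲(2)`-valued fine vector field `A` with `QTwS U₀ A = 0` is `A = S + toL2⁻¹(D_{U₀}(toL2S l))` with `S`, `l` `𝔰𝔲(2)`-valued,
`QTwS U₀ S = 0`, `RSPi U₀ (DstarPi U₀ S) = 0`, `toL2S l ∈ N_S(U₀)` — given the `QTwS` star-row and sector rows. [cite: Balaban1985BackgroundPropagators, (3.3) p.391, (3.21) p.394, (3.110) p.417; Balaban1985Variational, (51) p.286] -/
theorem exists_slice_add_gaugeDir_skew_pi [Fact (0 < cB)] (U₀ : GaugeField (F.P K) 0 (Matrix.specialUnitaryGroup (Fin 2) ℂ))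
    (hQ : ∀ A : PBond (F.P K) 0 → Matrix (Fin 2) (Fin 2) ℂ, QTwS F n K h U₀ (star A) = star (QTwS F n K h U₀ A))
    (hQtr : ∀ A : PBond (F.P K) 0 → Matrix (Fin 2) (Fin 2) ℂ, (∀ b, (A b).trace = 0) → ∀ c, (QTwS F n K h U₀ A c).trace = 0)
    (hQsc : ∀ c : PBond (F.P K) 0 → ℂ, ∃ d : PBond (F.P n) 0 → ℂ, QTwS F n K h U₀ (fun b => c b • (1 : Matrix (Fin 2) (Fin 2) ℂ)) = fun c' => d c' • 1)
    (A : PBond (F.P K) 0 → Matrix (Fin 2) (Fin 2) ℂ) (hAQ : QTwS F n K h U₀ A = 0) (hA : ∀ b, star (A b) = -A b ∧ (A b).trace = 0) :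
    ∃ (S : PBond (F.P K) 0 → Matrix (Fin 2) (Fin 2) ℂ) (l : Site (F.P K) 0 → Matrix (Fin 2) (Fin 2) ℂ),
      toL2S F K c₀ l ∈ NS F n K h c₀ cB U₀ ∧ (∀ x, star (l x) = -l x ∧ (l x).trace = 0) ∧ (∀ b, star (S b) = -S b ∧ (S b).trace = 0) ∧
        QTwS F n K h U₀ S = 0 ∧ RSPi F n K h c₀ cB U₀ (DstarPi F n K c₀ U₀ S) = 0 ∧ A = S + (toL2 F K c₀).symm (DL2 F n K c₀ U₀ (toL2S F K c₀ l)) := by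
  have hδQ : QL2 F n K h c₀ cB U₀ (toL2 F K c₀ A) = 0 := by rw [QL2_toL2, hAQ, map_zero]
  have hδ : ∀ b, star ((toL2 F K c₀).symm (toL2 F K c₀ A) b) = -(toL2 F K c₀).symm (toL2 F K c₀ A) b ∧ ((toL2 F K c₀).symm (toL2 F K c₀ A) b).trace = 0 := fun b => by
    rw [LinearEquiv.symm_apply_apply]; exact hA b
  obtain ⟨σ, l', hl', hl'R, hσR, hQσ, hRσ, hdec⟩ := exists_slice_add_gaugeDir_skew (h := h) (cB := cB) U₀ hQ hQtr hQsc (toL2 F K c₀ A) hδQ hδ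
  refine ⟨(toL2 F K c₀).symm σ, (toL2S F K c₀).symm l', by rwa [LinearEquiv.apply_symm_apply], fun x => hl'R x, fun b => hσR b, ?_, ?_, ?_⟩
  · have hQ' := hQσ
    rw [← (toL2 F K c₀).apply_symm_apply σ, QL2_toL2] at hQ'
    exact (toL2B F n cB).injective (by rw [hQ', map_zero])
  · rw [RSPi_apply, DstarPi_apply, LinearEquiv.apply_symm_apply, LinearEquiv.apply_symm_apply, hRσ, map_zero]
  · apply (toL2 F K c₀).injective
    rw [map_add, LinearEquiv.apply_symm_apply, LinearEquiv.apply_symm_apply, LinearEquiv.apply_symm_apply]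
    exact hdec

end SU2

end Summit.QuantumFields.YangMills.Theorems.Prop7GaugeSliceDecomposition

end
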